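import Mathlib
import Literature.NumberTheory.LFunctions.FractionalPartAutocorrelation
import HarnessLib

/-!
# The multiplicative autocorrelation of the fractional part is continuous on `[0, ∞)` (BBLS 2003, Prop. 85, first half)

Companion of `FractionalPartAutocorrelation.lean` (Báez-Duarte–Balazard–Landreau–Saias, arXiv:math/0306251): there
`fractAutocorr λ = A(λ) = ∫_0^∞ {t}{λt} dt/t²` is defined and the second half of Prop. 85 (the dilation symmetry
`A(λ) = λA(1/λ)`) is proved.  Here the first half:

* Prop. 85: «`A(λ)` est une fonction continue de `λ` pour `λ ≥ 0`» — `continuousOn_fractAutocorr`.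

Proof (ours; the source says only «continue»): dominated convergence (`MeasureTheory.continuousWithinAt_of_dominated`)
— for `0 ≤ λ ≤ Λ` the integrand is at most `Λ` on `(0,1]` (`{y} ≤ y`) and at most `t⁻²` on `(1,∞)`; for fixed `λ₀ > 0`
it is continuous in `λ` at `λ₀` for every `t` off the countable set `λ₀⁻¹ℤ` (`continuousAt_fract`), and at `λ₀ = 0` it
equals `{t}·λt/t²` for `0 ≤ λ < 1/t`.  Together with Vasyunin's formula at the rationals
(`Summit.RiemannHypothesis.RiemannHypothesis.Theorems.NbTheory.bbls2003_prop89_holds`) this determines `A` on `[0,∞)`.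
RH-free classical analysis (cell `pub/rh-li`, Nyman–Beurling Gram matrix).

## References
* [BBLS2003AutocorrelationNotes] L. Báez-Duarte, M. Balazard, B. Landreau, E. Saias, Sur l'autocorrélation multiplicative de
  la fonction partie fractionnaire, arXiv:math/0306251, Prop. 85.
-/

noncomputable section

namespace Literature.NumberTheory.LFunctions

open _root_.MeasureTheory _root_.Set


/-- The integrand of `A(λ)` is dominated, for `0 ≤ λ ≤ Λ`, by `Λ` on `(0,1]` and by `t⁻²` on `(1,∞)`. [folklore] -/
private theorem norm_fract_mul_fract_div_sq_le {lam Λ t : ℝ} (hlam : 0 ≤ lam) (hle : lam ≤ Λ) (ht : 0 < t) :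
    ‖Int.fract t * Int.fract (lam * t) / t ^ 2‖ ≤ if t ≤ 1 then Λ else t ^ (-2 : ℝ) := by
  have hnn : 0 ≤ Int.fract t * Int.fract (lam * t) / t ^ 2 :=
    div_nonneg (mul_nonneg (Int.fract_nonneg _) (Int.fract_nonneg _)) (sq_nonneg t)
  rw [Real.norm_of_nonneg hnn]
  have hfr : ∀ y : ℝ, 0 ≤ y → Int.fract y ≤ y := by
    intro y hy
    rw [← Int.self_sub_floor]
    have : (0 : ℝ) ≤ ⌊y⌋ := by exact_mod_cast Int.floor_nonneg.mpr hy
    linarith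
  split_ifs with h1
  · rw [div_le_iff₀ (by positivity)]
    calc Int.fract t * Int.fract (lam * t) ≤ t * (lam * t) :=
          mul_le_mul (hfr t ht.le) (hfr _ (by positivity)) (Int.fract_nonneg _) ht.le
      _ = lam * t ^ 2 := by ring
      _ ≤ Λ * t ^ 2 := by gcongr
  · rw [Real.rpow_neg ht.le, Real.rpow_two, div_eq_mul_inv]
    refine mul_le_of_le_one_left (inv_nonneg.mpr (sq_nonneg t)) ?_
    calc Int.fract t * Int.fract (lam * t) ≤ 1 * 1 :=
          mul_le_mul (Int.fract_lt_one _).le (Int.fract_lt_one _).le (Int.fract_nonneg _) zero_le_one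
      _ = 1 := one_mul 1

/-- The dominating function is integrable on `(0, ∞)`. [folklore] -/
private theorem integrableOn_bound (Λ : ℝ) :
    IntegrableOn (fun t : ℝ => if t ≤ 1 then Λ else t ^ (-2 : ℝ)) (Ioi 0) := by
  have h1 : IntegrableOn (fun t : ℝ => if t ≤ 1 then Λ else t ^ (-2 : ℝ)) (Ioc 0 1) := by
    refine (integrableOn_const (by simp) : IntegrableOn (fun _ : ℝ => Λ) (Ioc 0 1)).congr_fun ?_
      measurableSet_Ioc
    intro t ht
    simp [ht.2]
  have h2 : IntegrableOn (fun t : ℝ => if t ≤ 1 then Λ else t ^ (-2 : ℝ)) (Ioi 1) := by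
    refine (integrableOn_Ioi_rpow_of_lt (by norm_num : (-2 : ℝ) < -1) zero_lt_one).congr_fun ?_
      measurableSet_Ioi
    intro t ht
    have : ¬ t ≤ 1 := not_le.mpr ht
    simp [this]
  have h := h1.union h2
  rwa [Ioc_union_Ioi_eq_Ioi zero_le_one] at h

/-- **Prop. 85, first half: `A` is continuous on `[0, ∞)`** («`A(λ)` est une fonction continue de `λ` pour `λ ≥ 0`»;
dominated convergence: for `0 ≤ λ ≤ Λ` the integrand is at most `Λ` on `(0,1]` and `t⁻²` beyond, and for fixed `λ₀` it is
continuous in `λ` at `λ₀` for every `t ∉ λ₀⁻¹ℤ`). [cite: BBLS2003AutocorrelationNotes, Prop. 85] -/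
theorem continuousOn_fractAutocorr : ContinuousOn fractAutocorr (Ici 0) := by
  intro lam0 hlam0
  rw [mem_Ici] at hlam0
  -- the neighbourhood `[0, λ₀ + 1)` within `[0, ∞)`
  have hnhds : {lam : ℝ | 0 ≤ lam ∧ lam < lam0 + 1} ∈ nhdsWithin lam0 (Ici 0) := by
    have h1 : Iio (lam0 + 1) ∈ nhdsWithin lam0 (Ici 0) := mem_nhdsWithin_of_mem_nhds (Iio_mem_nhds (by linarith))
    filter_upwards [h1, self_mem_nhdsWithin] with lam hlt hge
    exact ⟨hge, hlt⟩
  have hmeas : ∀ lam : ℝ, AEStronglyMeasurable (fun t : ℝ => Int.fract t * Int.fract (lam * t) / t ^ 2)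
      (volume.restrict (Ioi 0)) := by
    intro lam
    refine Measurable.aestronglyMeasurable ?_
    exact ((measurable_fract.comp measurable_id).mul
      (measurable_fract.comp (measurable_const.mul measurable_id))).div (measurable_id.pow_const 2)
  refine continuousWithinAt_of_dominated (bound := fun t : ℝ => if t ≤ 1 then lam0 + 1 else t ^ (-2 : ℝ))
    (Filter.Eventually.of_forall hmeas) ?_ (integrableOn_bound (lam0 + 1)) ?_
  · filter_upwards [hnhds] with lam hlam
    refine (ae_restrict_iff' measurableSet_Ioi).mpr (ae_of_all _ fun t ht => ?_)
    exact norm_fract_mul_fract_div_sq_le hlam.1 hlam.2.le ht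
  · -- continuity in `λ` at `λ₀` for every `t > 0` off the countable set `{k/λ₀ : k ∈ ℤ, k ≠ 0}`
    have hB : (Set.range (fun k : ℤ => (k : ℝ) / lam0)).Countable := Set.countable_range _
    have hae : ∀ᵐ t ∂(volume.restrict (Ioi (0 : ℝ))), t ∉ Set.range (fun k : ℤ => (k : ℝ) / lam0) :=
      ae_restrict_of_ae (hB.ae_notMem _)
    filter_upwards [hae, ae_restrict_mem measurableSet_Ioi] with t htB ht
    rw [mem_Ioi] at ht
    have hcont_mul : Continuous fun lam : ℝ => lam * t := continuous_id.mul continuous_const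
    rcases eq_or_lt_of_le hlam0 with h0 | hpos
    · -- `λ₀ = 0`: on `[0, 1/t)` the integrand is `{t}·(λt)/t²`
      subst h0
      have hev : ∀ᶠ lam in nhdsWithin (0 : ℝ) (Ici 0),
          Int.fract t * Int.fract (lam * t) / t ^ 2 = Int.fract t * (lam * t) / t ^ 2 := by
        have h1 : Iio (1 / t) ∈ nhdsWithin (0 : ℝ) (Ici 0) := mem_nhdsWithin_of_mem_nhds (Iio_mem_nhds (by positivity))
        filter_upwards [h1, self_mem_nhdsWithin] with lam hlt hge
        rw [mem_Ici] at hge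
        rw [mem_Iio, lt_div_iff₀ ht] at hlt
        rw [Int.fract_eq_self.mpr ⟨by positivity, hlt⟩]
      refine (ContinuousWithinAt.congr_of_eventuallyEq ?_ hev ?_)
      · exact ((continuous_const.mul hcont_mul).div_const _).continuousWithinAt
      · simp
    · -- `λ₀ > 0`, `λ₀ t ∉ ℤ`: `fract` is continuous at `λ₀ t`
      have hne : lam0 * t ≠ ⌊lam0 * t⌋ := by
        intro h
        apply htB
        refine ⟨⌊lam0 * t⌋, ?_⟩
        show (⌊lam0 * t⌋ : ℝ) / lam0 = t
        rw [← h, mul_div_cancel_left₀ t hpos.ne']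
      have h2 : ContinuousAt (fun lam : ℝ => Int.fract (lam * t)) lam0 :=
        ContinuousAt.comp (g := Int.fract) (f := fun lam : ℝ => lam * t) (x := lam0)
          (continuousAt_fract hne) hcont_mul.continuousAt
      have hc : ContinuousAt (fun lam : ℝ => Int.fract t * Int.fract (lam * t) / t ^ 2) lam0 :=
        (continuousAt_const.mul h2).div_const _
      exact hc.continuousWithinAt

end Literature.NumberTheory.LFunctions

end
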